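import Mathlib
import HarnessLib
import Summits.CriticalPhenomena.SAWScalingLimit.Theses.SAWTotalPositivity

/-!
# Sketch — crux-ideate stmt-CriticalPhenomena-10687 (TPToTraversalBound), ideator 3

First lemmas of the idea cards (typed over existing declarations):
* `CrossRatioSubmult` (card long-rooms-pair-short-sides): the crossing/rim cross-ratio of the SAW
  boundary kernel is sub-multiplicative under concatenation of rooms — a provable-now consequence
  of `BoundaryTP2` (two instances of TP₂ at the posts of the separating door, multiplied).
* `ParallelRatioSubmult`: the parallel/rim ratio version (three instances).
* `RectangleGap`: the cheapest-falsifier form of the one-scale strict inequality ("first ε").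
* `RimPushMonotone` (card bad-slices-are-free): domain-monotonicity of the pairing ratio
  (conjecture; numerically supported), typed intrinsically in the style of `BoundaryTP2`.
-/

namespace Summit.CriticalPhenomena.SAWScalingLimit.Cruxes.TPToTraversalBound.Sketch

open Literature.Probability.RandomPlanarGeometry Literature.Probability.LatticeModels
open Summit.CriticalPhenomena.SAWScalingLimit.Theses.SAWTotalPositivity

noncomputable section

/-- The critical SAW boundary kernel `Z_Ω(u,v) = Σ_{γ : u → v} x_c^{|γ|}` (total mass of `SAW.weight`). -/
abbrev Z (Ω : Set ℂ) (δ : ℝ) (u v : Site 2) : ENNReal := SAW.weight Ω δ u v Set.univ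

/-- The three intrinsic provisos of `BoundaryTP2` for a cyclic quadruple `(p₁,p₂,p₃,p₄)`:
`{p₁,p₃}` interlaces `{p₂,p₄}` and both non-crossing pairings are disjointly realisable. -/
def Interlaced (Ω : Set ℂ) (δ : ℝ) (p₁ p₂ p₃ p₄ : Site 2) : Prop :=
  (∀ (P : SAW.DomainSAW Ω δ p₁ p₃) (Q : SAW.DomainSAW Ω δ p₂ p₄),
      ∃ v, v ∈ P.walk.support ∧ v ∈ Q.walk.support) ∧
  (∃ (P : SAW.DomainSAW Ω δ p₁ p₂) (Q : SAW.DomainSAW Ω δ p₃ p₄),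
      List.Disjoint P.walk.support Q.walk.support) ∧
  (∃ (P : SAW.DomainSAW Ω δ p₁ p₄) (Q : SAW.DomainSAW Ω δ p₂ p₃),
      List.Disjoint P.walk.support Q.walk.support)

/-- **Cross-ratio sub-multiplicativity** (card `long-rooms-pair-short-sides`, first lemma).
Six boundary posts in cyclic order `m, q, d, d', q', m'` of a simply connected lattice domain: the
room `Q = (m,d,d',m')` is cut by the door `(q,q')` into `Q₁ = (m,q,q',m')` and `Q₂ = (q,d,d',q')`.
With `crs(Q) = Z(m,d')Z(d,m')`, `rim(q,q') = Z(q,q')`: `crs(Q)·Z(q,q')·Z(q',q) ≤ crs(Q₁)·crs(Q₂)`,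
i.e. `X(Q) ≤ X(Q₁)·X(Q₂)` for `X := crs/rims` (the rims `Z(m,m')`, `Z(d,d')` cancel).
It is the product of the two "door lemma" instances of TP₂ at `(q',m,q,d')` and `(m',q,d,q')`. -/
def CrossRatioSubmult : Prop :=
  ∀ (Ω : Set ℂ) (δ : ℝ) (m q d d' q' m' : Site 2),
    Bornology.IsBounded Ω → SimplyConnectedSpace Ω → 0 < δ →
    Interlaced Ω δ q' m q d' → Interlaced Ω δ m' q d q' →
    Z Ω δ q' q * Z Ω δ m d' * (Z Ω δ m' d * Z Ω δ q q') ≤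
      Z Ω δ q' m * Z Ω δ q d' * (Z Ω δ m' q * Z Ω δ d q')

/-- `BoundaryTP2 → CrossRatioSubmult`: provable now (two TP₂ instances multiplied). -/
theorem crossRatioSubmult_of_boundaryTP2 (hTP : BoundaryTP2) : CrossRatioSubmult := by
  intro Ω δ m q d d' q' m' hB hS hδ h1 h2
  exact mul_le_mul' (hTP Ω δ q' m q d' hB hS hδ h1.1 h1.2.1 h1.2.2)
    (hTP Ω δ m' q d q' hB hS hδ h2.1 h2.2.1 h2.2.2)

/-- **Parallel-ratio sub-multiplicativity**: with `par(Q) = Z(m,d)Z(m',d')`,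
`par(Q)·Z(q,q')² ≤ par(Q₁)·par(Q₂)`, i.e. `σ(Q) ≤ σ(Q₁)·X(Q₂) ≤ σ(Q₁)·σ(Q₂)` for `σ := par/rims`
(TP₂ at `(m,q,d,q')`, at `(q,d',q',m')` and at `(q,d,d',q')`). -/
def ParallelRatioSubmult : Prop :=
  ∀ (Ω : Set ℂ) (δ : ℝ) (m q d d' q' m' : Site 2),
    Bornology.IsBounded Ω → SimplyConnectedSpace Ω → 0 < δ →
    Interlaced Ω δ m q d q' → Interlaced Ω δ q d' q' m' → Interlaced Ω δ q d d' q' →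
    Z Ω δ m d * Z Ω δ q q' * (Z Ω δ q q' * Z Ω δ d' m') ≤
      Z Ω δ m q * Z Ω δ q' m' * (Z Ω δ q d * Z Ω δ d' q')

/-- `BoundaryTP2 → ParallelRatioSubmult` (three instances). -/
theorem parallelRatioSubmult_of_boundaryTP2 (hTP : BoundaryTP2) : ParallelRatioSubmult := by
  intro Ω δ m q d d' q' m' hB hS hδ h1 h2 h3
  have i1 : Z Ω δ m d * Z Ω δ q q' ≤ Z Ω δ m q * Z Ω δ d q' :=
    hTP Ω δ m q d q' hB hS hδ h1.1 h1.2.1 h1.2.2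
  have i2 : Z Ω δ q q' * Z Ω δ d' m' ≤ Z Ω δ q d' * Z Ω δ q' m' :=
    hTP Ω δ q d' q' m' hB hS hδ h2.1 h2.2.1 h2.2.2
  have i3 : Z Ω δ q d' * Z Ω δ d q' ≤ Z Ω δ q d * Z Ω δ d' q' :=
    hTP Ω δ q d d' q' hB hS hδ h3.1 h3.2.1 h3.2.2
  calc Z Ω δ m d * Z Ω δ q q' * (Z Ω δ q q' * Z Ω δ d' m')
      ≤ Z Ω δ m q * Z Ω δ d q' * (Z Ω δ q d' * Z Ω δ q' m') := mul_le_mul' i1 i2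
    _ = Z Ω δ m q * Z Ω δ q' m' * (Z Ω δ q d' * Z Ω δ d q') := by ring
    _ ≤ Z Ω δ m q * Z Ω δ q' m' * (Z Ω δ q d * Z Ω δ d' q') := mul_le_mul' le_rfl i3

/-- The `1 × 2` continuum box `(-1,1) × (-1/2,1/2)`; at mesh `δ = 1/(2N+1)` its lattice domain is the
site rectangle `[-2N,2N] × [-N,N]` (aspect `→ 2`). -/
def twoByOneBox : Set ℂ := {z : ℂ | |z.re| < 1 ∧ |z.im| < 1 / 2}

/-- **RectangleGap** (cheapest falsifier / the "first ε" in its most symmetric instance): along the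
long wall the critical boundary kernel between corners is uniformly smaller than across the short
side: `Z(A,D) ≤ θ·Z(A,B)`, `θ < 1`, `A = (-2N,-N)`, `D = (2N,-N)`, `B = (-2N,N)`, uniformly in `N`.
Equivalently `σ(2:1 rectangle) ≤ θ² < 1` (by the `D₂` symmetry `par = Z(A,D)²`, `rims = Z(A,B)²`).
Enumeration (this session): `Z(A,D)/Z(A,B) = 0.232, 0.185, 0.165` on `2×4, 3×6, 4×8` site boxes. -/
def RectangleGap : Prop :=
  ∃ θ : ℝ, θ < 1 ∧ ∀ N : ℕ, 1 ≤ N →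
    Z twoByOneBox (1 / (2 * (N : ℝ) + 1)) ![-(2 * (N : ℤ)), -(N : ℤ)] ![2 * (N : ℤ), -(N : ℤ)] ≤
      ENNReal.ofReal θ *
        Z twoByOneBox (1 / (2 * (N : ℝ) + 1)) ![-(2 * (N : ℤ)), -(N : ℤ)] ![-(2 * (N : ℤ)), (N : ℤ)]

/-- **RimPushMonotone** (card `bad-slices-are-free`, first lemma; CONJECTURE, numerically
supported): removing from `Ω` a region that hangs off the deep rim `[d,d']` of the room `(m,d,d',m')`
(intrinsically: every mouth-rim chord `m → m'` of `Ω_δ` that leaves `Ω'_δ` meets every deep-rim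
chord `d → d'` of `Ω'_δ`) can only INCREASE the parallel/rim ratio:
`σ_Ω ≤ σ_{Ω'}`, written multiplicatively. By relabelling (conjugate room) the same statement says
that removing a region hanging off a WALL can only DECREASE `σ` — the continuum shadow is the
monotonicity of the conformal modulus under pushing walls / rims. -/
def RimPushMonotone : Prop :=
  ∀ (Ω Ω' : Set ℂ) (δ : ℝ) (m d d' m' : Site 2),
    Bornology.IsBounded Ω → SimplyConnectedSpace Ω → SimplyConnectedSpace Ω' → Ω' ⊆ Ω → 0 < δ →
    Interlaced Ω' δ m d d' m' →
    (∀ (P : SAW.DomainSAW Ω δ m m'), (∃ v ∈ P.walk.support, v ∉ meshDomain Ω' δ) →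
        ∀ (Q : SAW.DomainSAW Ω' δ d d'), ∃ v, v ∈ P.walk.support ∧ v ∈ Q.walk.support) →
    Z Ω δ m d * Z Ω δ m' d' * (Z Ω' δ m m' * Z Ω' δ d d') ≤
      Z Ω' δ m d * Z Ω' δ m' d' * (Z Ω δ m m' * Z Ω δ d d')

/-- The continuum annulus `{1 < |z| < C}` (doubly connected; `SAW.weight` is defined on any `Ω`). -/
def annulusDomain (C : ℝ) : Set ℂ := {z : ℂ | 1 < ‖z‖ ∧ ‖z‖ < C}

/-- An outer boundary post of the lattice annulus: a site of `Ω_δ` with a lattice neighbour on or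
beyond the outer circle. -/
def IsOuterPost (C δ : ℝ) (u : Site 2) : Prop :=
  u ∈ meshDomain (annulusDomain C) δ ∧ ∃ v : Site 2, (zdGraph 2).Adj u v ∧ C ≤ ‖meshPoint δ v‖

/-- An inner boundary post: a site of `Ω_δ` with a lattice neighbour in the closed unit disc. -/
def IsInnerPost (C δ : ℝ) (u : Site 2) : Prop :=
  u ∈ meshDomain (annulusDomain C) δ ∧ ∃ v : Site 2, (zdGraph 2).Adj u v ∧ ‖meshPoint δ v‖ ≤ 1

/-- **AnnulusPairingGap** (card `bad-slices-are-free`, the ONE-family seed): in a thick enough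
lattice annulus at `x_c`, pairing an outer boundary post with an inner one is uniformly (in the
mesh and in the positions) less likely than pairing outer-with-outer and inner-with-inner:
`Z(a₁,b₁)·Z(a₂,b₂) ≤ θ·Z(a₁,a₂)·Z(b₁,b₂)`, `θ < 1`. It is the member-by-member bound for the
comparison family onto which σ-monotone carving/filling maps every annular slice of a slit domain. -/
def AnnulusPairingGap : Prop :=
  ∃ C θ : ℝ, 1 < C ∧ θ < 1 ∧ ∀ δ : ℝ, 0 < δ →
    ∀ a₁ a₂ b₁ b₂ : Site 2, a₁ ≠ a₂ → b₁ ≠ b₂ →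
      IsOuterPost C δ a₁ → IsOuterPost C δ a₂ → IsInnerPost C δ b₁ → IsInnerPost C δ b₂ →
      Z (annulusDomain C) δ a₁ b₁ * Z (annulusDomain C) δ a₂ b₂ ≤
        ENNReal.ofReal θ * (Z (annulusDomain C) δ a₁ a₂ * Z (annulusDomain C) δ b₁ b₂)

end

end Summit.CriticalPhenomena.SAWScalingLimit.Cruxes.TPToTraversalBound.Sketch
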